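import Mathlib.RingTheory.Artinian.Ring
import Mathlib.Algebra.Ring.GeomSum
import Mathlib.Algebra.Group.Units.Equiv
import Mathlib.Tactic.NoncommRing
import Mathlib.Tactic.Group
import Mathlib.Tactic.Abel
import HarnessLib

/-!
# Cocycle averaging for graded lift systems (lens-1, generation 27, file 2 of 3)

Support file (abstract engine, no matrices) for the census cell `A = EquivariantDialNode.EqHardBiPerm`
(item `stmt-ValiantsHypothesis-23702`).  HONEST SCOPE — five standing sentences: NOT a route, closes NO item.
VP ≠ VNP is NOT proved here and nothing below is progress on it.
The cell A (EqHardBiPerm) itself is NOT proved (here or in files 1, 3); 0 S-currency.  The series' residual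
LocalShrinking [status: PAPER; NOT proved in the tree; typed ONLY as a hypothesis: no _holds, no instance, no default argument]
is declared in file 3 only and does not occur here.
CONTENT.  A `P`-GRADED LIFT SYSTEM (`IsGradedLift L φ`): subspaces `L a ⊆ E` (`a : P`, a group) with
`1 ∈ L 1`, `L a · L b ⊆ L (a * b)`, and a linear functional `φ` that is a character of `L 1`;
`J := L 1 ⊓ ker φ`.  For unit lifts `x a ∈ L a`, `(x a)⁻¹ ∈ L a⁻¹` the cocycle `c(a,b) := x_a x_b x_{ab}⁻¹`
lies in `L 1`, `φ c ≠ 0`; its DEFECT `φ(c)⁻¹ c − 1` lies in `J`.  ★ `IsGradedLift.exists_projective_lifts`: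
`P` finite, `char k = 0`, `J ^ N = 0` ⟹ the lifts can be corrected inside the `L a` to PROJECTIVELY
MULTIPLICATIVE ones (`y_a y_b = μ • y_{ab}`, `μ ≠ 0`) — finite-group averaging [Babakhanian 1972, §15.8]
run along `J ⊇ J² ⊇ …` (`exists_scalarModPow_succ`: defects in `J^(i+1)` and
`x_a ↦ (1 − |P|⁻¹ Σ_g γ(a,g)) x_a` ⟹ defects in `J^(i+2)`, via `defect_cocycle_mem` and `key_mem`).
NON-VACUITY (K6): `IsGradedLift` is inhabited by the pair-lift spaces and trace character of file 1,
`(fun a => pairLift A ↑a⁻¹, pairTrace s k)` under `IsLocalRepr A` (file 3, `isGradedLift_pairLift`).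
-/

set_option linter.dupNamespace false
noncomputable section

namespace Summit.ValiantsHypothesis.ValiantsHypothesis.Theorems.EquivariantDialCocycleAveraging

/-- A `P`-GRADED LIFT SYSTEM: subspaces `L a ⊆ E` with `1 ∈ L 1`, `L a · L b ⊆ L (a * b)`, and a
linear functional `φ` which is a character on `L 1` (`φ 1 = 1`, multiplicative). -/
structure IsGradedLift {k E P : Type*} [Field k] [Ring E] [Algebra k E] [Group P]
    (L : P → Submodule k E) (φ : E →ₗ[k] k) : Prop where
  one_mem : (1 : E) ∈ L 1
  mul_mem : ∀ {a b : P} {y z : E}, y ∈ L a → z ∈ L b → y * z ∈ L (a * b)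
  map_one : φ 1 = 1
  map_mul : ∀ {y z : E}, y ∈ L 1 → z ∈ L 1 → φ (y * z) = φ y * φ z

variable {k E P : Type*} [Field k] [Ring E] [Algebra k E] [Group P]
  {L : P → Submodule k E} {φ : E →ₗ[k] k}
/-- `L 1` is closed under multiplication. -/
theorem IsGradedLift.mul_mem_one (hL : IsGradedLift L φ) {y z : E} (hy : y ∈ L 1)
    (hz : z ∈ L 1) : y * z ∈ L 1 := by
  simpa only [mul_one] using hL.mul_mem hy hz
/-- `L 1` is closed under powers. -/
theorem IsGradedLift.pow_mem_one (hL : IsGradedLift L φ) {y : E} (hy : y ∈ L 1) (n : ℕ) :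
    y ^ n ∈ L 1 := by
  induction n with
  | zero => rw [pow_zero]; exact hL.one_mem
  | succ n ih => rw [pow_succ]; exact hL.mul_mem_one ih hy
/-- `φ` is multiplicative on powers of an element of `L 1`. -/
theorem IsGradedLift.map_pow (hL : IsGradedLift L φ) {y : E} (hy : y ∈ L 1) (n : ℕ) :
    φ (y ^ n) = φ y ^ n := by
  induction n with
  | zero => rw [pow_zero, pow_zero, hL.map_one]
  | succ n ih => rw [pow_succ, hL.map_mul (hL.pow_mem_one hy n) hy, ih, pow_succ]
/-- Conjugation by a unit of `L a` with inverse in `L a⁻¹` preserves `L 1`. -/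
theorem IsGradedLift.conj_mem_one (hL : IsGradedLift L φ) {a : P} {u : Eˣ} (hu : (u : E) ∈ L a)
    (hu' : ((u⁻¹ : Eˣ) : E) ∈ L a⁻¹) {y : E} (hy : y ∈ L 1) :
    (u : E) * y * ((u⁻¹ : Eˣ) : E) ∈ L 1 := by
  simpa only [mul_one, mul_inv_cancel] using hL.mul_mem (hL.mul_mem hu hy) hu'
/-- `J = L 1 ⊓ ker φ` is a left ideal of `L 1`: `L 1 · J ⊆ J`. -/
theorem IsGradedLift.mul_mem_nil (hL : IsGradedLift L φ) {y z : E} (hy : y ∈ L 1)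
    (hz : z ∈ L 1 ⊓ LinearMap.ker φ) : y * z ∈ L 1 ⊓ LinearMap.ker φ := by
  rw [Submodule.mem_inf, LinearMap.mem_ker] at hz ⊢
  exact ⟨hL.mul_mem_one hy hz.1, by rw [hL.map_mul hy hz.1, hz.2, mul_zero]⟩
/-- `J = L 1 ⊓ ker φ` is a right ideal of `L 1`: `J · L 1 ⊆ J`. -/
theorem IsGradedLift.nil_mul_mem (hL : IsGradedLift L φ) {y z : E} (hy : y ∈ L 1 ⊓ LinearMap.ker φ)
    (hz : z ∈ L 1) : y * z ∈ L 1 ⊓ LinearMap.ker φ := by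
  rw [Submodule.mem_inf, LinearMap.mem_ker] at hy ⊢
  exact ⟨hL.mul_mem_one hy.1 hz, by rw [hL.map_mul hy.1 hz, hy.2, zero_mul]⟩
/-- `y - φ(y) · 1 ∈ J` for `y ∈ L 1`, i.e. `L 1 = k · 1 + J`. -/
theorem IsGradedLift.sub_smul_one_mem (hL : IsGradedLift L φ) {y : E} (hy : y ∈ L 1) :
    y - φ y • (1 : E) ∈ L 1 ⊓ LinearMap.ker φ := by
  rw [Submodule.mem_inf, LinearMap.mem_ker]
  refine ⟨Submodule.sub_mem _ hy (Submodule.smul_mem _ _ hL.one_mem), ?_⟩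
  rw [map_sub, map_smul, hL.map_one, smul_eq_mul, mul_one, sub_self]
/-- `L 1 · J^(n+1) ⊆ J^(n+1)`. -/
theorem IsGradedLift.mul_mem_pow (hL : IsGradedLift L φ) (n : ℕ) {y z : E} (hy : y ∈ L 1)
    (hz : z ∈ (L 1 ⊓ LinearMap.ker φ) ^ (n + 1)) : y * z ∈ (L 1 ⊓ LinearMap.ker φ) ^ (n + 1) := by
  induction n generalizing z with
  | zero => rw [zero_add, pow_one] at hz ⊢; exact hL.mul_mem_nil hy hz
  | succ n ih =>
    rw [pow_succ] at hz ⊢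
    refine Submodule.mul_induction_on hz (fun m hm n' hn' => ?_) (fun v w hv hw => ?_)
    · rw [← mul_assoc]; exact Submodule.mul_mem_mul (ih (z := m) hm) hn'
    · rw [mul_add]; exact Submodule.add_mem _ hv hw
/-- `J^(n+1) · L 1 ⊆ J^(n+1)`. -/
theorem IsGradedLift.pow_mul_mem (hL : IsGradedLift L φ) (n : ℕ) {y z : E}
    (hy : y ∈ (L 1 ⊓ LinearMap.ker φ) ^ (n + 1)) (hz : z ∈ L 1) :
    y * z ∈ (L 1 ⊓ LinearMap.ker φ) ^ (n + 1) := by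
  induction n generalizing y with
  | zero => rw [zero_add, pow_one] at hy ⊢; exact hL.nil_mul_mem hy hz
  | succ n ih =>
    rw [pow_succ'] at hy ⊢
    refine Submodule.mul_induction_on hy (fun m hm n' hn' => ?_) (fun v w hv hw => ?_)
    · rw [mul_assoc]; exact Submodule.mul_mem_mul hm (ih (y := n') hn')
    · rw [add_mul]; exact Submodule.add_mem _ hv hw
/-- `J^(n+1) ⊆ J`. -/
theorem IsGradedLift.pow_succ_le (hL : IsGradedLift L φ) (n : ℕ) :
    (L 1 ⊓ LinearMap.ker φ) ^ (n + 1) ≤ L 1 ⊓ LinearMap.ker φ := by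
  induction n with
  | zero => simp
  | succ n ih =>
    rw [pow_succ]
    exact Submodule.mul_le.mpr fun m hm z hz => hL.mul_mem_nil (Submodule.mem_inf.mp (ih hm)).1 hz
/-- The powers of `J` decrease: `J^(j+1) ⊆ J^(i+1)` for `i ≤ j`. -/
theorem IsGradedLift.pow_le_pow (hL : IsGradedLift L φ) {i j : ℕ} (h : i ≤ j) :
    (L 1 ⊓ LinearMap.ker φ) ^ (j + 1) ≤ (L 1 ⊓ LinearMap.ker φ) ^ (i + 1) := by
  obtain ⟨d, rfl⟩ := Nat.exists_eq_add_of_le h; clear h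
  induction d with
  | zero => simp
  | succ d ih =>
    rw [show i + (d + 1) + 1 = (i + d + 1) + 1 from by omega, pow_succ]
    refine le_trans (Submodule.mul_le.mpr fun m hm n' hn' => ?_) ih
    exact hL.pow_mul_mem (i + d) hm (Submodule.mem_inf.mp hn').1
/-- `J^(a+1) · J^(b+1) ⊆ J^(a+b+2)`. -/
theorem pow_mul_pow_mem (J : Submodule k E) {a b : ℕ} {y z : E} (hy : y ∈ J ^ (a + 1))
    (hz : z ∈ J ^ (b + 1)) : y * z ∈ J ^ (a + b + 2) := by
  rw [show a + b + 2 = (a + 1) + (b + 1) from by omega, pow_add]; exact Submodule.mul_mem_mul hy hz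
/-- If `J^N = 0` then `y^N = 0` for every `y ∈ J`. -/
theorem pow_eq_zero_of_mem {J : Submodule k E} {N : ℕ} (hN : J ^ N = ⊥) {y : E} (hy : y ∈ J) :
    y ^ N = 0 := by
  simpa only [hN, Submodule.mem_bot] using Submodule.pow_mem_pow J hy N
/-- `φ` kills every `y ∈ L 1` with `y^N = 0` (`N ≥ 1`). -/
theorem IsGradedLift.map_eq_zero_of_pow_eq_zero (hL : IsGradedLift L φ) {N : ℕ} (hN0 : 0 < N)
    {y : E} (hy : y ∈ L 1) (h : y ^ N = 0) : φ y = 0 := by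
  have h1 := hL.map_pow hy N; rw [h, map_zero] at h1
  exact (pow_eq_zero_iff hN0.ne').mp h1.symm
/-- Conjugation by a graded unit preserves `J` (for `J` nilpotent). -/
theorem IsGradedLift.conj_mem_nil (hL : IsGradedLift L φ) {N : ℕ} (hN0 : 0 < N)
    (hN : (L 1 ⊓ LinearMap.ker φ) ^ N = ⊥) {a : P} {u : Eˣ} (hu : (u : E) ∈ L a)
    (hu' : ((u⁻¹ : Eˣ) : E) ∈ L a⁻¹) {y : E} (hy : y ∈ L 1 ⊓ LinearMap.ker φ) :
    (u : E) * y * ((u⁻¹ : Eˣ) : E) ∈ L 1 ⊓ LinearMap.ker φ := by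
  have h1 := hL.conj_mem_one hu hu' (Submodule.mem_inf.mp hy).1
  refine Submodule.mem_inf.mpr ⟨h1, LinearMap.mem_ker.mpr (hL.map_eq_zero_of_pow_eq_zero hN0 h1 ?_)⟩
  rw [Units.conj_pow, pow_eq_zero_of_mem hN hy, mul_zero, zero_mul]
/-- Conjugation by a graded unit preserves every power `J^(n+1)` (for `J` nilpotent). -/
theorem IsGradedLift.conj_mem_pow (hL : IsGradedLift L φ) {N : ℕ} (hN0 : 0 < N)
    (hN : (L 1 ⊓ LinearMap.ker φ) ^ N = ⊥) (n : ℕ) {a : P} {u : Eˣ} (hu : (u : E) ∈ L a)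
    (hu' : ((u⁻¹ : Eˣ) : E) ∈ L a⁻¹) {y : E} (hy : y ∈ (L 1 ⊓ LinearMap.ker φ) ^ (n + 1)) :
    (u : E) * y * ((u⁻¹ : Eˣ) : E) ∈ (L 1 ⊓ LinearMap.ker φ) ^ (n + 1) := by
  induction n generalizing y with
  | zero => rw [zero_add, pow_one] at hy ⊢; exact hL.conj_mem_nil hN0 hN hu hu' hy
  | succ n ih =>
    rw [pow_succ] at hy ⊢
    refine Submodule.mul_induction_on hy (fun m hm n' hn' => ?_) (fun v w hv hw => ?_)
    · simpa only [mul_assoc, Units.inv_mul_cancel_left] using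
        Submodule.mul_mem_mul (ih (y := m) hm) (hL.conj_mem_nil hN0 hN hu hu' hn')
    · rw [mul_add, add_mul]; exact Submodule.add_mem _ hv hw
/-- `φ` is invariant under conjugation by graded units (for `J` nilpotent). -/
theorem IsGradedLift.map_conj (hL : IsGradedLift L φ) {N : ℕ} (hN0 : 0 < N)
    (hN : (L 1 ⊓ LinearMap.ker φ) ^ N = ⊥) {a : P} {u : Eˣ} (hu : (u : E) ∈ L a)
    (hu' : ((u⁻¹ : Eˣ) : E) ∈ L a⁻¹) {y : E} (hy : y ∈ L 1) :
    φ ((u : E) * y * ((u⁻¹ : Eˣ) : E)) = φ y := by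
  have h1 := hL.conj_mem_nil hN0 hN hu hu' (hL.sub_smul_one_mem hy)
  rw [Submodule.mem_inf, LinearMap.mem_ker] at h1
  have h2 : (u : E) * y * ((u⁻¹ : Eˣ) : E)
      = (u : E) * (y - φ y • (1 : E)) * ((u⁻¹ : Eˣ) : E) + φ y • (1 : E) := by
    rw [mul_sub, sub_mul, mul_smul_comm, mul_one, smul_mul_assoc, Units.mul_inv, sub_add_cancel]
  rw [h2, map_add, h1.2, zero_add, map_smul, hL.map_one, smul_eq_mul, mul_one]
/-- For `d ∈ J` (`J` nilpotent), `1 - d` is a unit whose inverse lies in `L 1`. -/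
theorem IsGradedLift.exists_unit_one_sub (hL : IsGradedLift L φ) {N : ℕ}
    (hN : (L 1 ⊓ LinearMap.ker φ) ^ N = ⊥) {d : E} (hd : d ∈ L 1 ⊓ LinearMap.ker φ) :
    ∃ v : Eˣ, (v : E) = 1 - d ∧ ((v⁻¹ : Eˣ) : E) ∈ L 1 := by
  refine ⟨⟨1 - d, ∑ i ∈ Finset.range N, d ^ i, ?_, ?_⟩, rfl, ?_⟩
  · rw [mul_neg_geom_sum, pow_eq_zero_of_mem hN hd, sub_zero]
  · rw [geom_sum_mul_neg, pow_eq_zero_of_mem hN hd, sub_zero]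
  · show (∑ i ∈ Finset.range N, d ^ i) ∈ L 1
    exact Submodule.sum_mem _ fun i _ => hL.pow_mem_one (Submodule.mem_inf.mp hd).1 i

/-- The COCYCLE of a lift family: `c(a,b) = x_a x_b x_{ab}⁻¹`. -/
def cocycle (x : P → Eˣ) (a b : P) : Eˣ := x a * x b * (x (a * b))⁻¹
/-- The 2-cocycle identity `c(a,b) · c(ab,g) = x_a c(b,g) x_a⁻¹ · c(a,bg)`. -/
theorem cocycle_mul_cocycle (x : P → Eˣ) (a b g : P) :
    cocycle x a b * cocycle x (a * b) g = x a * cocycle x b g * (x a)⁻¹ * cocycle x a (b * g) := by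
  simp only [cocycle]; rw [← mul_assoc a b g]; group
/-- The cocycle of a rescaled family `a ↦ w_a x_a` in terms of the cocycle of `x`. -/
theorem cocycle_mul_left (w x : P → Eˣ) (a b : P) :
    cocycle (fun a => w a * x a) a b
      = w a * (x a * w b * (x a)⁻¹) * cocycle x a b * (w (a * b))⁻¹ := by
  simp only [cocycle]; group
/-- Cocycle values of a graded lift family lie in `L 1`. -/
theorem IsGradedLift.cocycle_mem (hL : IsGradedLift L φ) {x : P → Eˣ} (hx : ∀ a, (x a : E) ∈ L a)
    (hx' : ∀ a, (((x a)⁻¹ : Eˣ) : E) ∈ L a⁻¹) (a b : P) : (cocycle x a b : E) ∈ L 1 := by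
  have h := hL.mul_mem (hL.mul_mem (hx a) (hx b)) (hx' (a * b)); rw [mul_inv_cancel] at h
  simpa only [cocycle, Units.val_mul] using h
/-- Inverses of cocycle values of a graded lift family lie in `L 1`. -/
theorem IsGradedLift.cocycle_inv_mem (hL : IsGradedLift L φ) {x : P → Eˣ}
    (hx : ∀ a, (x a : E) ∈ L a) (hx' : ∀ a, (((x a)⁻¹ : Eˣ) : E) ∈ L a⁻¹) (a b : P) :
    (((cocycle x a b)⁻¹ : Eˣ) : E) ∈ L 1 := by
  have h := hL.mul_mem (hL.mul_mem (hx (a * b)) (hx' b)) (hx' a)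
  rw [mul_inv_cancel_right, mul_inv_cancel] at h
  simpa only [cocycle, mul_inv_rev, inv_inv, Units.val_mul, mul_assoc] using h
/-- `φ(c(a,b)) ≠ 0`: `φ` is multiplicative on `L 1` and `c(a,b)` is a unit of `L 1`. -/
theorem IsGradedLift.map_cocycle_ne_zero (hL : IsGradedLift L φ) {x : P → Eˣ}
    (hx : ∀ a, (x a : E) ∈ L a) (hx' : ∀ a, (((x a)⁻¹ : Eˣ) : E) ∈ L a⁻¹) (a b : P) :
    φ (cocycle x a b : E) ≠ 0 := by
  intro h
  have h1 := hL.map_mul (hL.cocycle_mem hx hx' a b) (hL.cocycle_inv_mem hx hx' a b)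
  rw [Units.mul_inv, hL.map_one, h, zero_mul] at h1; exact one_ne_zero h1

/-- The DEFECT `γ(a,b) = φ(c)⁻¹ · c(a,b) − 1` (so that `c = φ(c) · (1 + γ)`). -/
def defect (φ : E →ₗ[k] k) (x : P → Eˣ) (a b : P) : E :=
  (φ (cocycle x a b : E))⁻¹ • (cocycle x a b : E) - 1

/-- The AVERAGED DEFECT `d(a) = |P|⁻¹ · Σ_g γ(a,g)`. -/
def avgDefect [Fintype P] (φ : E →ₗ[k] k) (x : P → Eˣ) (a : P) : E :=
  (Fintype.card P : k)⁻¹ • ∑ g, defect φ x a g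

/-- `ScalarModPow L φ x i`: every cocycle value is a scalar modulo `J^(i+1)`, `J = L 1 ⊓ ker φ`. -/
def ScalarModPow (L : P → Submodule k E) (φ : E →ₗ[k] k) (x : P → Eˣ) (i : ℕ) : Prop :=
  ∀ a b : P, (cocycle x a b : E) - φ (cocycle x a b : E) • (1 : E)
    ∈ (L 1 ⊓ LinearMap.ker φ) ^ (i + 1)
/-- Every cocycle value is a scalar modulo `J`: `ScalarModPow` holds at level `0`. -/
theorem IsGradedLift.scalarModPow_zero (hL : IsGradedLift L φ) {x : P → Eˣ}
    (hx : ∀ a, (x a : E) ∈ L a) (hx' : ∀ a, (((x a)⁻¹ : Eˣ) : E) ∈ L a⁻¹) :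
    ScalarModPow L φ x 0 := by
  intro a b; rw [zero_add, pow_one]; exact hL.sub_smul_one_mem (hL.cocycle_mem hx hx' a b)
/-- `c(a,b) = φ(c(a,b)) · (1 + γ(a,b))`. -/
theorem smul_one_add_defect {x : P → Eˣ} {a b : P} (h : φ (cocycle x a b : E) ≠ 0) :
    φ (cocycle x a b : E) • (1 + defect φ x a b) = cocycle x a b := by
  rw [defect, ← add_sub_assoc, add_comm (1 : E), add_sub_cancel_right, smul_smul,
    mul_inv_cancel₀ h, one_smul]
/-- Under `ScalarModPow L φ x i` every defect lies in `J^(i+1)`. -/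
theorem IsGradedLift.defect_mem (hL : IsGradedLift L φ) {x : P → Eˣ} (hx : ∀ a, (x a : E) ∈ L a)
    (hx' : ∀ a, (((x a)⁻¹ : Eˣ) : E) ∈ L a⁻¹) {i : ℕ} (hi : ScalarModPow L φ x i) (a b : P) :
    defect φ x a b ∈ (L 1 ⊓ LinearMap.ker φ) ^ (i + 1) := by
  have e : defect φ x a b
      = (φ (cocycle x a b : E))⁻¹ • ((cocycle x a b : E) - φ (cocycle x a b : E) • (1 : E)) := by
    rw [smul_sub, smul_smul, inv_mul_cancel₀ (hL.map_cocycle_ne_zero hx hx' a b), one_smul, defect]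
  rw [e]; exact Submodule.smul_mem _ _ (hi a b)
/-- A ring identity used in the correction step (expansion of `(1-d)(1-e)(1+γ)v - 1`). -/
theorem step_identity (d e γ d' v : E) (hv : (1 - d') * v = 1) :
    (1 - d) * (1 - e) * (1 + γ) * v - 1
      = (γ - e - d + d') * v + (d * e + d * e * γ - d * γ - e * γ) * v := by
  have h : (1 - d) * (1 - e) * (1 + γ)
      = (1 - d') + (γ - e - d + d') + (d * e + d * e * γ - d * γ - e * γ) := by noncomm_ring
  rw [h, add_mul, add_mul, hv]; abel
/-- Linearisation: `(1+γ₁)(1+γ₂) = (1+e₃)(1+γ₄)` gives `γ₁ + γ₂ - e₃ - γ₄ = e₃γ₄ - γ₁γ₂`. -/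
theorem linearised_identity {γ₁ γ₂ e₃ γ₄ : E}
    (h : (1 + γ₁) * (1 + γ₂) = (1 + e₃) * (1 + γ₄)) :
    γ₁ + γ₂ - e₃ - γ₄ = e₃ * γ₄ - γ₁ * γ₂ := by
  have h' : γ₁ + γ₂ - e₃ - γ₄ - (e₃ * γ₄ - γ₁ * γ₂)
      = (1 + γ₁) * (1 + γ₂) - (1 + e₃) * (1 + γ₄) := by noncomm_ring
  rw [h, sub_self] at h'; exact sub_eq_zero.mp h'
/-- The linearised cocycle identity: the defects form an additive 2-cocycle modulo `J^(i+2)`. -/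
theorem IsGradedLift.defect_cocycle_mem (hL : IsGradedLift L φ) {N : ℕ} (hN0 : 0 < N)
    (hN : (L 1 ⊓ LinearMap.ker φ) ^ N = ⊥) {x : P → Eˣ} (hx : ∀ a, (x a : E) ∈ L a)
    (hx' : ∀ a, (((x a)⁻¹ : Eˣ) : E) ∈ L a⁻¹) {i : ℕ} (hi : ScalarModPow L φ x i) (a b g : P) :
    defect φ x a b + defect φ x (a * b) g - (x a : E) * defect φ x b g * (((x a)⁻¹ : Eˣ) : E)
      - defect φ x a (b * g) ∈ (L 1 ⊓ LinearMap.ker φ) ^ (i + 2) := by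
  have hc := hL.cocycle_mem hx hx'; have hd := hL.defect_mem hx hx' hi
  have hE : (cocycle x a b : E) * (cocycle x (a * b) g : E)
      = (x a : E) * (cocycle x b g : E) * (((x a)⁻¹ : Eˣ) : E) * (cocycle x a (b * g) : E) := by
    have h := congrArg Units.val (cocycle_mul_cocycle x a b g)
    simpa only [Units.val_mul] using h
  have hΛ : φ (cocycle x a b : E) * φ (cocycle x (a * b) g : E)
      = φ (cocycle x b g : E) * φ (cocycle x a (b * g) : E) := by
    rw [← hL.map_mul (hc a b) (hc (a * b) g), hE,
      hL.map_mul (hL.conj_mem_one (hx a) (hx' a) (hc b g)) (hc a (b * g)),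
      hL.map_conj hN0 hN (hx a) (hx' a) (hc b g)]
  have hsc : (φ (cocycle x a b : E))⁻¹ * (φ (cocycle x (a * b) g : E))⁻¹
      = (φ (cocycle x a (b * g) : E))⁻¹ * (φ (cocycle x b g : E))⁻¹ := by
    rw [← mul_inv, ← mul_inv, hΛ, mul_comm]
  have hu : ∀ a' b' : P,
      (1 : E) + defect φ x a' b' = (φ (cocycle x a' b' : E))⁻¹ • (cocycle x a' b' : E) :=
    fun a' b' => by rw [defect]; abel
  have he : (x a : E) * (1 + defect φ x b g) * (((x a)⁻¹ : Eˣ) : E)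
      = 1 + (x a : E) * defect φ x b g * (((x a)⁻¹ : Eˣ) : E) := by
    rw [mul_add, mul_one, add_mul, Units.mul_inv]
  have h1 : ((1 : E) + defect φ x a b) * (1 + defect φ x (a * b) g)
      = (1 + (x a : E) * defect φ x b g * (((x a)⁻¹ : Eˣ) : E)) * (1 + defect φ x a (b * g)) := by
    rw [← he, hu, hu, hu, hu, smul_mul_assoc, mul_smul_comm, smul_smul, mul_smul_comm,
      mul_smul_comm, smul_mul_assoc, smul_mul_assoc, smul_smul, hsc, hE]
  rw [linearised_identity h1]; refine Submodule.sub_mem _ ?_ ?_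
  · exact hL.pow_le_pow (i := i + 1) (j := i + i + 1) (by omega)
      (pow_mul_pow_mem _ (hL.conj_mem_pow hN0 hN i (hx a) (hx' a) (hd b g)) (hd a (b * g)))
  · exact hL.pow_le_pow (i := i + 1) (j := i + i + 1) (by omega)
      (pow_mul_pow_mem _ (hd a b) (hd (a * b) g))
/-- The averaged defect lies in `J^(i+1)`. -/
theorem IsGradedLift.avgDefect_mem [Fintype P] (hL : IsGradedLift L φ) {x : P → Eˣ}
    (hx : ∀ a, (x a : E) ∈ L a) (hx' : ∀ a, (((x a)⁻¹ : Eˣ) : E) ∈ L a⁻¹) {i : ℕ}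
    (hi : ScalarModPow L φ x i) (a : P) : avgDefect φ x a ∈ (L 1 ⊓ LinearMap.ker φ) ^ (i + 1) := by
  unfold avgDefect
  exact Submodule.smul_mem _ _ (Submodule.sum_mem _ fun g _ => hL.defect_mem hx hx' hi a g)
/-- Key congruence: `γ(a,b) ≡ x_a d(b) x_a⁻¹ + d(a) - d(ab)` modulo `J^(i+2)` (average of the cocycle identity over the last variable). -/
theorem IsGradedLift.key_mem [CharZero k] [Fintype P] (hL : IsGradedLift L φ) {N : ℕ}
    (hN0 : 0 < N) (hN : (L 1 ⊓ LinearMap.ker φ) ^ N = ⊥) {x : P → Eˣ} (hx : ∀ a, (x a : E) ∈ L a)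
    (hx' : ∀ a, (((x a)⁻¹ : Eˣ) : E) ∈ L a⁻¹) {i : ℕ} (hi : ScalarModPow L φ x i) (a b : P) :
    defect φ x a b - (x a : E) * avgDefect φ x b * (((x a)⁻¹ : Eˣ) : E) - avgDefect φ x a
      + avgDefect φ x (a * b) ∈ (L 1 ⊓ LinearMap.ker φ) ^ (i + 2) := by
  have hP : (Fintype.card P : k) ≠ 0 := Nat.cast_ne_zero.mpr Fintype.card_ne_zero
  have hsum : ∑ g, (defect φ x a b - (x a : E) * defect φ x b g * (((x a)⁻¹ : Eˣ) : E)
      - defect φ x a (b * g) + defect φ x (a * b) g) ∈ (L 1 ⊓ LinearMap.ker φ) ^ (i + 2) :=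
    Submodule.sum_mem _ fun g _ => by
      convert hL.defect_cocycle_mem hN0 hN hx hx' hi a b g using 1; abel
  have hA : defect φ x a b = (Fintype.card P : k)⁻¹ • ∑ _g : P, defect φ x a b := by
    rw [Finset.sum_const, Finset.card_univ, ← Nat.cast_smul_eq_nsmul k, smul_smul,
      inv_mul_cancel₀ hP, one_smul]
  have hC : (x a : E) * avgDefect φ x b * (((x a)⁻¹ : Eˣ) : E)
      = (Fintype.card P : k)⁻¹ • ∑ g, (x a : E) * defect φ x b g * (((x a)⁻¹ : Eˣ) : E) := by
    rw [avgDefect, mul_smul_comm, smul_mul_assoc, Finset.mul_sum, Finset.sum_mul]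
  have hD : avgDefect φ x a = (Fintype.card P : k)⁻¹ • ∑ g, defect φ x a (b * g) := by
    rw [avgDefect, Fintype.sum_equiv (Equiv.mulLeft b) (fun g => defect φ x a (b * g))
      (fun g => defect φ x a g) (fun g => by simp only [Equiv.coe_mulLeft])]
  rw [hC, hD, hA, avgDefect, ← smul_sub, ← smul_sub, ← smul_add, ← Finset.sum_sub_distrib,
    ← Finset.sum_sub_distrib, ← Finset.sum_add_distrib]
  exact Submodule.smul_mem _ _ hsum
/-- Correction step: rescaling by `1 - d(a)` improves `ScalarModPow` from level `i` to level `i + 1`. -/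
theorem IsGradedLift.exists_scalarModPow_succ [CharZero k] [Fintype P] (hL : IsGradedLift L φ)
    {N : ℕ} (hN0 : 0 < N) (hN : (L 1 ⊓ LinearMap.ker φ) ^ N = ⊥) {x : P → Eˣ}
    (hx : ∀ a, (x a : E) ∈ L a) (hx' : ∀ a, (((x a)⁻¹ : Eˣ) : E) ∈ L a⁻¹) {i : ℕ}
    (hi : ScalarModPow L φ x i) :
    ∃ x' : P → Eˣ, (∀ a, (x' a : E) ∈ L a) ∧ (∀ a, (((x' a)⁻¹ : Eˣ) : E) ∈ L a⁻¹) ∧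
      ScalarModPow L φ x' (i + 1) := by
  have hdi : ∀ a, avgDefect φ x a ∈ (L 1 ⊓ LinearMap.ker φ) ^ (i + 1) := hL.avgDefect_mem hx hx' hi
  have hdJ : ∀ a, avgDefect φ x a ∈ L 1 ⊓ LinearMap.ker φ := fun a => hL.pow_succ_le i (hdi a)
  choose w hw hw' using fun a => hL.exists_unit_one_sub hN (hdJ a)
  have hw1 : ∀ a, (w a : E) ∈ L 1 := fun a => by
    rw [hw]; exact Submodule.sub_mem _ hL.one_mem (Submodule.mem_inf.mp (hdJ a)).1
  refine ⟨fun a => w a * x a, fun a => ?_, fun a => ?_, ?_⟩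
  · show ((w a * x a : Eˣ) : E) ∈ L a
    have h := hL.mul_mem (hw1 a) (hx a); rwa [one_mul, ← Units.val_mul] at h
  · show (((w a * x a)⁻¹ : Eˣ) : E) ∈ L a⁻¹
    have h := hL.mul_mem (hx' a) (hw' a); rwa [mul_one, ← Units.val_mul, ← mul_inv_rev] at h
  intro a b
  have hne := hL.map_cocycle_ne_zero hx hx' a b
  have hγ : defect φ x a b ∈ (L 1 ⊓ LinearMap.ker φ) ^ (i + 1) := hL.defect_mem hx hx' hi a b
  have he : (x a : E) * avgDefect φ x b * (((x a)⁻¹ : Eˣ) : E)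
      ∈ (L 1 ⊓ LinearMap.ker φ) ^ (i + 1) := hL.conj_mem_pow hN0 hN i (hx a) (hx' a) (hdi b)
  -- new cocycle value `= μ • T`, `μ = φ(c)`, `T = (1 − d)(1 − e)(1 + γ) v`, and `T - 1 ∈ J^(i+2)`
  set μ : k := φ (cocycle x a b : E)
  have e1 : μ • (1 + defect φ x a b) = (cocycle x a b : E) := smul_one_add_defect hne
  have hv : (1 - avgDefect φ x (a * b)) * (((w (a * b))⁻¹ : Eˣ) : E) = 1 := by
    rw [← hw (a * b), Units.mul_inv]
  have hxe : (x a : E) * (1 - avgDefect φ x b) * (((x a)⁻¹ : Eˣ) : E)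
      = 1 - (x a : E) * avgDefect φ x b * (((x a)⁻¹ : Eˣ) : E) := by
    rw [mul_sub, mul_one, sub_mul, Units.mul_inv]
  have hc' : ((w a * (x a * w b * (x a)⁻¹) * cocycle x a b * (w (a * b))⁻¹ : Eˣ) : E)
      = μ • ((1 - avgDefect φ x a) * (1 - (x a : E) * avgDefect φ x b * (((x a)⁻¹ : Eˣ) : E))
          * (1 + defect φ x a b) * (((w (a * b))⁻¹ : Eˣ) : E)) := by
    simp only [Units.val_mul]
    rw [hw a, hw b, hxe, ← e1, mul_smul_comm, smul_mul_assoc]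
  have hK := hL.key_mem hN0 hN hx hx' hi a b
  have hde : avgDefect φ x a * ((x a : E) * avgDefect φ x b * (((x a)⁻¹ : Eˣ) : E))
      ∈ (L 1 ⊓ LinearMap.ker φ) ^ (i + 2) :=
    hL.pow_le_pow (i := i + 1) (j := i + i + 1) (by omega) (pow_mul_pow_mem _ (hdi a) he)
  have hQ : avgDefect φ x a * ((x a : E) * avgDefect φ x b * (((x a)⁻¹ : Eˣ) : E))
      + avgDefect φ x a * ((x a : E) * avgDefect φ x b * (((x a)⁻¹ : Eˣ) : E)) * defect φ x a b
      - avgDefect φ x a * defect φ x a b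
      - (x a : E) * avgDefect φ x b * (((x a)⁻¹ : Eˣ) : E) * defect φ x a b
      ∈ (L 1 ⊓ LinearMap.ker φ) ^ (i + 2) := by
    refine Submodule.sub_mem _ (Submodule.sub_mem _ (Submodule.add_mem _ hde ?_) ?_) ?_
    · exact hL.pow_mul_mem (i + 1) hde (Submodule.mem_inf.mp (hL.pow_succ_le i hγ)).1
    · exact hL.pow_le_pow (i := i + 1) (j := i + i + 1) (by omega)
        (pow_mul_pow_mem _ (hdi a) hγ)
    · exact hL.pow_le_pow (i := i + 1) (j := i + i + 1) (by omega) (pow_mul_pow_mem _ he hγ)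
  have hT : (1 - avgDefect φ x a) * (1 - (x a : E) * avgDefect φ x b * (((x a)⁻¹ : Eˣ) : E))
      * (1 + defect φ x a b) * (((w (a * b))⁻¹ : Eˣ) : E) - 1
      ∈ (L 1 ⊓ LinearMap.ker φ) ^ (i + 2) := by
    rw [step_identity _ _ _ _ _ hv]
    exact Submodule.add_mem _ (hL.pow_mul_mem (i + 1) hK (hw' (a * b)))
      (hL.pow_mul_mem (i + 1) hQ (hw' (a * b)))
  have hφT : φ ((1 - avgDefect φ x a) * (1 - (x a : E) * avgDefect φ x b * (((x a)⁻¹ : Eˣ) : E))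
      * (1 + defect φ x a b) * (((w (a * b))⁻¹ : Eˣ) : E)) = 1 := by
    have h := (Submodule.mem_inf.mp (hL.pow_succ_le (i + 1) hT)).2
    rwa [LinearMap.mem_ker, map_sub, hL.map_one, sub_eq_zero] at h
  show (cocycle (fun a => w a * x a) a b : E) - φ (cocycle (fun a => w a * x a) a b : E) • (1 : E)
    ∈ (L 1 ⊓ LinearMap.ker φ) ^ (i + 1 + 1)
  rw [cocycle_mul_left w x a b, hc', map_smul, hφT, smul_eq_mul, mul_one, ← smul_sub]
  exact Submodule.smul_mem _ _ hT
/-- ★ COCYCLE AVERAGING: over a field of characteristic `0`, for `P` finite and `J = L 1 ⊓ ker φ` nilpotent (`J^N = 0`, `N ≥ 1`), every graded family of units (`x_a ∈ L a`, `x_a⁻¹ ∈ L a⁻¹`) can be replaced by one with the same membership that is a PROJECTIVE LIFT: `y_a y_b = μ(a,b) · y_{ab}` with scalars `μ(a,b) ≠ 0`. -/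
theorem IsGradedLift.exists_projective_lifts [CharZero k] [Finite P] (hL : IsGradedLift L φ)
    {N : ℕ} (hN0 : 0 < N) (hN : (L 1 ⊓ LinearMap.ker φ) ^ N = ⊥) (x : P → Eˣ)
    (hx : ∀ a, (x a : E) ∈ L a) (hx' : ∀ a, (((x a)⁻¹ : Eˣ) : E) ∈ L a⁻¹) :
    ∃ y : P → Eˣ, (∀ a, (y a : E) ∈ L a) ∧ (∀ a, (((y a)⁻¹ : Eˣ) : E) ∈ L a⁻¹) ∧
      ∀ a b : P, ∃ μ : k, μ ≠ 0 ∧ (y a : E) * (y b : E) = μ • (y (a * b) : E) := by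
  haveI := Fintype.ofFinite P
  have key : ∀ n : ℕ, ∃ y : P → Eˣ, (∀ a, (y a : E) ∈ L a) ∧
      (∀ a, (((y a)⁻¹ : Eˣ) : E) ∈ L a⁻¹) ∧ ScalarModPow L φ y n := by
    intro n
    induction n with
    | zero => exact ⟨x, hx, hx', hL.scalarModPow_zero hx hx'⟩
    | succ n ih => obtain ⟨y, hy, hy', hn⟩ := ih; exact hL.exists_scalarModPow_succ hN0 hN hy hy' hn
  obtain ⟨y, hy, hy', hsc⟩ := key (N - 1)
  refine ⟨y, hy, hy', fun a b => ⟨φ (cocycle y a b : E), hL.map_cocycle_ne_zero hy hy' a b, ?_⟩⟩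
  have h1 := hsc a b; rw [Nat.sub_add_cancel hN0, hN, Submodule.mem_bot, sub_eq_zero] at h1
  have h2 : (y a : E) * (y b : E) = (cocycle y a b : E) * (y (a * b) : E) := by
    rw [← Units.val_mul, ← Units.val_mul, cocycle, inv_mul_cancel_right]
  rw [h2]; conv_lhs => rw [h1, smul_mul_assoc, one_mul]

end Summit.ValiantsHypothesis.ValiantsHypothesis.Theorems.EquivariantDialCocycleAveraging
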